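import Summits.MatrixMultiplication.MatrixMultiplication.Theorems.ShapeSubmodularityPerfectAmortisationStubCwRectRestriction
import Literature.Computability.AlgebraicComplexity.LaserMethodTypeCount
import Literature.Computability.AlgebraicComplexity.LaserMethodBigCW
import Literature.Computability.AlgebraicComplexity.MaxEntropyGivenMarginals
import Literature.Computability.AlgebraicComplexity.AsymptoticRankMultiplesMatMul
import Literature.Computability.AlgebraicComplexity.CoppersmithWinograd1990Proofs
import Literature.Computability.AlgebraicComplexity.BigCoppersmithWinogradProofs
import Literature.Computability.AlgebraicComplexity.RectangularExponentBounds
import Literature.Computability.AlgebraicComplexity.RectangularExponentSubadditivity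
import Literature.Computability.AlgebraicComplexity.RectangularExponentSymmetry
import Literature.Computability.AlgebraicComplexity.RectangularExponentHomogeneity
import Literature.Barriers.MatrixMultiplication.UniversalMethodBarrierAsymptoticRank
import HarnessLib

/-!
# `ω(5, 1, 3) ≤ 8` (route `SaturationLadder`, stmt-MatrixMultiplication-25914) — file 1/2: layers B1 and B2

Layer B1 `cw8DiagonalRaw`: a large free diagonal of the joint type `(5m, m, 3m, m)` of the first-power `CW_8` laser
method (tree `exists_free_diagonal_jointType_card`); layer B2: entropy evaluation of the law `(5,1,3,1)/10` on the
CW support (marginals, `Γ_S(P) = 0`, `min(H_Y,H_Z) ≥ H_X` in closed form `3 log 3 ≤ 5 log 2`), and `cw8Diagonal`.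

Landing note: the lens-1 kernel `GradeOneThirdCert.lean` (decomp-mm gen 3; sha256 7a2649f7…, 560 lines, rc 0 ·
0 sorry · std axioms, re-probed rc 0 by critic 03:41:21Z and census-trib-mm-2 03:50:47Z) is landed as two files for
the gate rule «Theorems files with proofs ≤ 400 lines» — `SaturationLadderGradeOneThirdCertDiagonal` (layers B1,
B2: free diagonal of the joint type `(5m, m, 3m, m)`, entropy evaluation of the law `(5,1,3,1)/10`, `cw8Diagonal`)
and `SaturationLadderGradeOneThirdCert` (layer C `cw8Threshold`, assembly `ω(5,1,3) ≤ 8`, the closers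
`gradeOneThirdCert_holds` / `gradeOneThird_holds` / `gradeRow033_holds`); statements and proofs unchanged (one
namespace `…Theorems.SaturationLadderGradeOneThirdCert`), except that the four small lemmas this kernel shared
verbatim with the sibling kernel `ExpSaturation.lean` (`loss_le_exp'`, `asymptoticRank_multiple_matMulTensor_congr`,
`rectAdmissibleExponents_anti`, `omegaRect_mono'`) are imported from the landed
`Theorems/SaturationLadderExpSaturation{Entropy,}.lean` instead of being restated, and `log 4 = 2 log 2`,
`log 6 = log 2 + log 3`, `log 8 = 3 log 2` (= the landed `Literature.NumberTheory.LFunctions.FordLambda.log_{4,6,8}_eq`)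
are one-line local `have`s at their two uses
(gate rule `dedup.landed`); the helper file imports no route (`Theses`) file (gate lint `theses-cone`).
The overview (certificate, references) is the module docstring of `Theorems/SaturationLadderGradeOneThirdCert.lean`.
-/

set_option linter.dupNamespace false
-- (single-conjunct summit: the namespace repeats `MatrixMultiplication`)

noncomputable section

open Finset
open scoped BigOperators

namespace Summit.MatrixMultiplication.MatrixMultiplication.Theorems.SaturationLadderGradeOneThirdCert

open Literature.Computability.AlgebraicComplexity
open Literature.Barriers.MatrixMultiplication
open Summit.MatrixMultiplication.MatrixMultiplication.Theorems.PerfectAmortisation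
  (stub_cwRectRestriction)

/-! ## Layer B1 — a large free diagonal of the joint type `(5m, m, 3m, m)` -/

/-- **Combinatorial layer.** For `m ≥ 1`, `N = 10 m` and `P = Q/N` with `Q(1,1,0) = 5m`,
`Q(0,1,1) = m`, `Q(1,0,1) = 3m`, `Q(2,0,0) = m` (`0` elsewhere), there is a family `Δ` of triples
of level words, coordinatewise in `cwSupport₃ = {i+j+l = 2}`, each with exactly `5m`, `m`, `3m`
positions of pattern `(1,1,0)`, `(0,1,1)`, `(1,0,1)`, forming a free diagonal, with
`2^{N (min_m H(P_m) − Γ_S(P))} ≤ |Δ| · (N+1)^63 · 192 · exp(4 √(log 6 + N log 27))`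
(`exists_free_diagonal_jointType_card` for `S = cwSupport₃`, `b = 2`, `G = 27`, `A = 9`; proof
copied from the tree's `stub_cwRectDiagonalRaw` with the joint type changed).
[cite: LeGall2014, Appendix A.3, Eq. (7) and p. 24] -/
theorem cw8DiagonalRaw :
    ∀ m : ℕ, 1 ≤ m → ∀ P : Fin 3 × Fin 3 × Fin 3 → ℝ,
      (∀ s, P s = ((if s = (1, 1, 0) then m * 5 else if s = (0, 1, 1) then m
          else if s = (1, 0, 1) then m * 3 else if s = (2, 0, 0) then m else 0 : ℕ) : ℝ) /
            (((10 * m : ℕ)) : ℝ)) →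
      ∃ Δ : Finset ((Fin (10 * m) → Fin 3) × (Fin (10 * m) → Fin 3) × (Fin (10 * m) → Fin 3)),
        (∀ δ ∈ Δ, ∀ ρ, labelSeq δ ρ ∈ cwSupport₃) ∧
        (∀ δ ∈ Δ, letterCount (labelSeq δ) (1, 1, 0) = m * 5 ∧ letterCount (labelSeq δ) (0, 1, 1) = m ∧
          letterCount (labelSeq δ) (1, 0, 1) = m * 3) ∧
        (∀ δ ∈ Δ, ∀ δ' ∈ Δ, ∀ δ'' ∈ Δ, (∀ ρ, (δ.1 ρ, δ'.2.1 ρ, δ''.2.2 ρ) ∈ cwSupport₃) →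
          δ = δ' ∧ δ' = δ'') ∧
        (2 : ℝ) ^ ((((10 * m : ℕ)) : ℝ) *
            (min (shannonEntropy (marginalDist₁ P))
              (min (shannonEntropy (marginalDist₂ P)) (shannonEntropy (marginalDist₃ P))) -
              maxEntropyPenalty cwSupport₃ P)) ≤
          (Δ.card : ℝ) * ((((10 * m : ℕ)) : ℝ) + 1) ^ 63 * 192 *
            Real.exp (4 * Real.sqrt (Real.log 6 + (((10 * m : ℕ)) : ℝ) * Real.log 27)) := by
  intro m hm P hP
  classical
  -- tightness data of `cwSupport₃` (as in `bigCw_laser_inequality`)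
  have hinj : Function.Injective fun (i : Fin 3) (_ : Fin 1) => (i : ℤ) := by
    intro i i' h
    have h0 := congrFun h 0
    simp only [Nat.cast_inj] at h0
    exact Fin.ext h0
  have hinjγ : Function.Injective fun (l : Fin 3) (_ : Fin 1) => (l : ℤ) - 2 := by
    intro l l' h
    have h0 := congrFun h 0
    simp only [sub_left_inj, Nat.cast_inj] at h0
    exact Fin.ext h0
  have hbd : ∀ (i : Fin 3) (ρ : Fin 1), |((fun (i : Fin 3) (_ : Fin 1) => (i : ℤ)) i ρ)| ≤ (2 : ℕ) := by
    intro i ρ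
    have := i.isLt
    simp only [Nat.cast_ofNat, Nat.abs_cast]
    omega
  have htight : ∀ s ∈ cwSupport₃, ∀ ρ : Fin 1,
      (fun (i : Fin 3) (_ : Fin 1) => (i : ℤ)) s.1 ρ + (fun (j : Fin 3) (_ : Fin 1) => (j : ℤ)) s.2.1 ρ +
        (fun (l : Fin 3) (_ : Fin 1) => (l : ℤ) - 2) s.2.2 ρ = 0 := by
    intro s hs ρ
    rw [mem_cwSupport₃] at hs
    simp only
    omega
  -- the joint type `Q` and `N = 10 m`
  obtain ⟨Q, hQdef⟩ : ∃ Q : Fin 3 × Fin 3 × Fin 3 → ℕ, Q = fun s =>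
      if s = (1, 1, 0) then m * 5 else if s = (0, 1, 1) then m else if s = (1, 0, 1) then m * 3
      else if s = (2, 0, 0) then m else 0 :=
    ⟨_, rfl⟩
  have hN : 0 < 10 * m := by omega
  have hQS : ∀ s, s ∉ cwSupport₃ → Q s = 0 := by
    intro s hs
    rw [mem_cwSupport₃_iff] at hs
    push Not at hs
    obtain ⟨h1, h2, h3, h4, -, -⟩ := hs
    simp [hQdef, h1, h2, h3, h4]
  have hQ : ∑ s, Q s = 10 * m := by
    rw [sum_triple_eq, hQdef]
    simp [Fin.sum_univ_three]
    ring
  have hP' : ∀ s, P s = (Q s : ℝ) / (((10 * m : ℕ)) : ℝ) := by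
    intro s
    rw [hQdef]
    exact hP s
  -- the tree theorem
  obtain ⟨Δ, hΔQ, hfree, hsize⟩ := exists_free_diagonal_jointType_card cwSupport₃ (r := 1) (b := 2)
    (fun (i : Fin 3) (_ : Fin 1) => (i : ℤ)) (fun (j : Fin 3) (_ : Fin 1) => (j : ℤ))
    (fun (l : Fin 3) (_ : Fin 1) => (l : ℤ) - 2) hinj hinj hinjγ hbd hbd htight hN Q hQS hQ P hP'
  have hQδ : ∀ δ ∈ Δ, letterCount (labelSeq δ) = Q := fun δ hδ => (Finset.mem_filter.1 (hΔQ hδ)).2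
  refine ⟨Δ, ?_, ?_, hfree, ?_⟩
  · -- coordinatewise support
    intro δ hδ ρ
    by_contra hρ
    have h0 := hQS _ hρ
    rw [← hQδ δ hδ] at h0
    exact (letterCount_pos_of_apply (labelSeq δ) ρ).ne' h0
  · -- the three letter counts
    intro δ hδ
    rw [hQδ δ hδ, hQdef]
    simp
  · -- the size bound, constants evaluated
    refine hsize.trans_eq ?_
    have hmax : (max 2 1 : ℕ) = 2 := by decide
    generalize (((10 * m : ℕ)) : ℝ) = Nr
    simp only [Fintype.card_prod, Fintype.card_fin, hmax]
    norm_num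
    simp only [mul_assoc]

/-! ## Layer B2 — entropy evaluation of the law `(5, 1, 3, 1)/10` on the CW support -/

/-- The three marginals of the law `5/10` on `(1,1,0)`, `1/10` on `(0,1,1)`, `3/10` on `(1,0,1)`,
`1/10` on `(2,0,0)`: `(1, 8, 1)/10`, `(4, 6, 0)/10`, `(6, 4, 0)/10`. [folklore] -/
theorem marginalDist_cert {P : Fin 3 × Fin 3 × Fin 3 → ℝ}
    (hP : ∀ s, P s = if s = (1, 1, 0) then 5 / 10 else if s = (0, 1, 1) then 1 / 10
      else if s = (1, 0, 1) then 3 / 10 else if s = (2, 0, 0) then 1 / 10 else 0) :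
    marginalDist₁ P = ![1 / 10, 8 / 10, 1 / 10] ∧ marginalDist₂ P = ![4 / 10, 6 / 10, 0] ∧
      marginalDist₃ P = ![6 / 10, 4 / 10, 0] := by
  refine ⟨?_, ?_, ?_⟩ <;> funext i <;> fin_cases i <;>
    simp [marginalDist₁, marginalDist₂, marginalDist₃, Fin.sum_univ_three, hP] <;> norm_num

/-- The law vanishes off the support `{i + j + l = 2}` of `CW_q`. [folklore] -/
theorem cert_eq_zero_of_not_mem {P : Fin 3 × Fin 3 × Fin 3 → ℝ}
    (hP : ∀ s, P s = if s = (1, 1, 0) then 5 / 10 else if s = (0, 1, 1) then 1 / 10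
      else if s = (1, 0, 1) then 3 / 10 else if s = (2, 0, 0) then 1 / 10 else 0)
    {s : Fin 3 × Fin 3 × Fin 3} (hs : s ∉ cwSupport₃) : P s = 0 := by
  rw [mem_cwSupport₃_iff] at hs
  push Not at hs
  rw [hP]
  simp [hs.1, hs.2.1, hs.2.2.1, hs.2.2.2.1]

/-- **`D(P) = {P}`**: a distribution supported in `{i + j + l = 2}` with the marginals of the law
above coincides with it — the level-`2` marginals in `Y` and `Z` vanish, killing `(0,2,0)` and
`(0,0,2)`, the `X`-marginal at level `2` fixes `(2,0,0)`, and then each matrix pattern is read off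
from one level-`0` marginal. [folklore] -/
theorem eq_of_mem_sameMarginalsOn_cert {P P' : Fin 3 × Fin 3 × Fin 3 → ℝ}
    (hP : ∀ s, P s = if s = (1, 1, 0) then 5 / 10 else if s = (0, 1, 1) then 1 / 10
      else if s = (1, 0, 1) then 3 / 10 else if s = (2, 0, 0) then 1 / 10 else 0)
    (hP' : P' ∈ sameMarginalsOn cwSupport₃ P) : P' = P := by
  obtain ⟨-, hoff, h₁, h₂, h₃⟩ := hP'
  obtain ⟨hm₁, hm₂, hm₃⟩ := marginalDist_cert hP
  -- the off-support zeros of `P'`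
  have z : ∀ a b c : Fin 3, (a : ℕ) + b + c ≠ 2 → P' (a, b, c) = 0 := fun a b c h =>
    hoff _ (mt mem_cwSupport₃.1 h)
  -- the six marginal equations we use
  have e₁ : marginalDist₁ P' 2 = 1 / 10 := by rw [h₁, hm₁]; simp
  have e₂ : marginalDist₂ P' 2 = 0 := by rw [h₂, hm₂]; simp
  have e₃ : marginalDist₃ P' 2 = 0 := by rw [h₃, hm₃]; simp
  have f₁ : marginalDist₁ P' 0 = 1 / 10 := by rw [h₁, hm₁]; simp
  have f₂ : marginalDist₂ P' 0 = 4 / 10 := by rw [h₂, hm₂]; simp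
  have f₃ : marginalDist₃ P' 0 = 6 / 10 := by rw [h₃, hm₃]; simp
  simp (disch := decide) only [marginalDist₁, marginalDist₂, marginalDist₃, Fin.sum_univ_three, z,
    add_zero, zero_add] at e₁ e₂ e₃ f₁ f₂ f₃
  -- `e₁ : P' (2,0,0) = 1/10`, `e₂ : P' (0,2,0) = 0`, `e₃ : P' (0,0,2) = 0`,
  -- `f₁ : P' (0,0,2) + P' (0,1,1) + P' (0,2,0) = 1/10`, …
  have p011 : P' (0, 1, 1) = 1 / 10 := by linarith
  have p101 : P' (1, 0, 1) = 3 / 10 := by linarith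
  have p110 : P' (1, 1, 0) = 5 / 10 := by linarith
  funext s
  by_cases hs : s ∈ cwSupport₃
  · rw [hP]
    rw [mem_cwSupport₃_iff] at hs
    rcases hs with rfl | rfl | rfl | rfl | rfl | rfl <;> simp [p011, p101, p110, e₁, e₂, e₃]
  · rw [hoff s hs, cert_eq_zero_of_not_mem hP hs]

/-- **The penalty vanishes**: `Γ_S(P) = max_{D(P)} H − H(P) ≤ 0` for the law above (a distribution
supported in `S` with `D(P) = {P}`). [folklore] -/
theorem maxEntropyPenalty_cert_nonpos {P : Fin 3 × Fin 3 × Fin 3 → ℝ}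
    (hP : ∀ s, P s = if s = (1, 1, 0) then 5 / 10 else if s = (0, 1, 1) then 1 / 10
      else if s = (1, 0, 1) then 3 / 10 else if s = (2, 0, 0) then 1 / 10 else 0) :
    maxEntropyPenalty cwSupport₃ P ≤ 0 := by
  have hsimplex : P ∈ stdSimplex ℝ (Fin 3 × Fin 3 × Fin 3) := by
    refine ⟨fun s => ?_, ?_⟩
    · rw [hP]
      split_ifs <;> norm_num
    · rw [sum_triple_eq]
      simp [Fin.sum_univ_three, hP]
      norm_num
  have hsupp : ∀ x, x ∉ cwSupport₃ → P x = 0 := fun x hx => cert_eq_zero_of_not_mem hP hx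
  have hle : maxEntropyGivenMarginals cwSupport₃ P ≤ shannonEntropy P :=
    maxEntropyGivenMarginals_le ⟨P, self_mem_sameMarginalsOn hsimplex hsupp⟩
      fun P' hP' => (congrArg shannonEntropy (eq_of_mem_sameMarginalsOn_cert hP hP')).le
  exact sub_nonpos.2 hle

/-- The side condition of the certificate, `min(H_Y, H_Z) ≥ H_X`, in closed form:
`3 log 3 ≤ 5 log 2` (`27 ≤ 32`). [folklore] -/
theorem three_log_three_le : 3 * Real.log 3 ≤ 5 * Real.log 2 := by
  have h : Real.log 27 ≤ Real.log 32 := Real.log_le_log (by norm_num) (by norm_num)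
  have h27 : Real.log 27 = 3 * Real.log 3 := by
    rw [show (27 : ℝ) = 3 ^ 3 by norm_num, Real.log_pow]; norm_num
  have h32 : Real.log 32 = 5 * Real.log 2 := by
    rw [show (32 : ℝ) = 2 ^ 5 by norm_num, Real.log_pow]; norm_num
  linarith

/-- `H(1/10, 8/10, 1/10) = (log 10 − (8/10) log 8) / log 2` (bits). [folklore] -/
theorem shannonEntropy_X :
    shannonEntropy ![(1 : ℝ) / 10, 8 / 10, 1 / 10] = (Real.log 10 - 8 / 10 * Real.log 8) / Real.log 2 := by
  rw [shannonEntropy_def, Fin.sum_univ_three]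
  congr 1
  have e1 : Real.negMulLog ((1 : ℝ) / 10) = 1 / 10 * Real.log 10 := by
    rw [Real.negMulLog, one_div, Real.log_inv]; ring
  have e2 : Real.negMulLog ((8 : ℝ) / 10) = 8 / 10 * Real.log 10 - 8 / 10 * Real.log 8 := by
    rw [Real.negMulLog, Real.log_div (by norm_num) (by norm_num)]; ring
  simp only [Matrix.cons_val_zero, Matrix.cons_val_one, Matrix.cons_val_two, Matrix.head_cons,
    Matrix.tail_cons]
  rw [e1, e2]; ring

/-- `H(4/10, 6/10, 0) ≥ (log 10 − (8/10) log 8) / log 2`, i.e. `h(2/5) ≥ H(1/10,8/10,1/10)`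
(`⟺ 3 log 3 ≤ 5 log 2`). [folklore] -/
theorem shannonEntropy_Y_ge :
    (Real.log 10 - 8 / 10 * Real.log 8) / Real.log 2 ≤ shannonEntropy ![(4 : ℝ) / 10, 6 / 10, 0] := by
  -- `log 4 = 2 log 2`, `log 6 = log 2 + log 3`, `log 8 = 3 log 2` (= the landed
  -- `Literature.NumberTheory.LFunctions.FordLambda.log_4_eq / log_6_eq / log_8_eq`), proved locally (one line
  -- each) rather than restated or imported across areas (gate rule `dedup.landed`).
  have log_four : Real.log 4 = 2 * Real.log 2 := by
    rw [show (4 : ℝ) = 2 ^ 2 by norm_num, Real.log_pow]; norm_num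
  have log_six : Real.log 6 = Real.log 2 + Real.log 3 := by
    rw [show (6 : ℝ) = 2 * 3 by norm_num, Real.log_mul (by norm_num) (by norm_num)]
  have log_eight : Real.log 8 = 3 * Real.log 2 := by
    rw [show (8 : ℝ) = 2 ^ 3 by norm_num, Real.log_pow]; norm_num
  rw [shannonEntropy_def, Fin.sum_univ_three]
  refine div_le_div_of_nonneg_right ?_ (Real.log_pos one_lt_two).le
  have e3 : Real.negMulLog ((4 : ℝ) / 10) = 4 / 10 * Real.log 10 - 4 / 10 * Real.log 4 := by
    rw [Real.negMulLog, Real.log_div (by norm_num) (by norm_num)]; ring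
  have e4 : Real.negMulLog ((6 : ℝ) / 10) = 6 / 10 * Real.log 10 - 6 / 10 * Real.log 6 := by
    rw [Real.negMulLog, Real.log_div (by norm_num) (by norm_num)]; ring
  simp only [Matrix.cons_val_zero, Matrix.cons_val_one, Matrix.cons_val_two, Matrix.head_cons,
    Matrix.tail_cons, Real.negMulLog_zero, add_zero]
  rw [e3, e4, log_four, log_six, log_eight]
  linarith [three_log_three_le]

/-- `H(6/10, 4/10, 0) ≥ (log 10 − (8/10) log 8) / log 2` (the same two summands). [folklore] -/
theorem shannonEntropy_Z_ge :
    (Real.log 10 - 8 / 10 * Real.log 8) / Real.log 2 ≤ shannonEntropy ![(6 : ℝ) / 10, 4 / 10, 0] := by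
  -- `log 4 = 2 log 2`, `log 6 = log 2 + log 3`, `log 8 = 3 log 2` (= the landed
  -- `Literature.NumberTheory.LFunctions.FordLambda.log_4_eq / log_6_eq / log_8_eq`), proved locally (one line
  -- each) rather than restated or imported across areas (gate rule `dedup.landed`).
  have log_four : Real.log 4 = 2 * Real.log 2 := by
    rw [show (4 : ℝ) = 2 ^ 2 by norm_num, Real.log_pow]; norm_num
  have log_six : Real.log 6 = Real.log 2 + Real.log 3 := by
    rw [show (6 : ℝ) = 2 * 3 by norm_num, Real.log_mul (by norm_num) (by norm_num)]
  have log_eight : Real.log 8 = 3 * Real.log 2 := by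
    rw [show (8 : ℝ) = 2 ^ 3 by norm_num, Real.log_pow]; norm_num
  rw [shannonEntropy_def, Fin.sum_univ_three]
  refine div_le_div_of_nonneg_right ?_ (Real.log_pos one_lt_two).le
  have e3 : Real.negMulLog ((4 : ℝ) / 10) = 4 / 10 * Real.log 10 - 4 / 10 * Real.log 4 := by
    rw [Real.negMulLog, Real.log_div (by norm_num) (by norm_num)]; ring
  have e4 : Real.negMulLog ((6 : ℝ) / 10) = 6 / 10 * Real.log 10 - 6 / 10 * Real.log 6 := by
    rw [Real.negMulLog, Real.log_div (by norm_num) (by norm_num)]; ring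
  simp only [Matrix.cons_val_zero, Matrix.cons_val_one, Matrix.cons_val_two, Matrix.head_cons,
    Matrix.tail_cons, Real.negMulLog_zero, add_zero]
  rw [e3, e4, log_four, log_six, log_eight]
  linarith [three_log_three_le]

/-- **Entropy layer.**  For `P = Q/N` (`Q = (5m, m, 3m, m)` on `(1,1,0), (0,1,1), (1,0,1), (2,0,0)`,
`N = 10m`): `log 2 · (min_m H(P_m) − Γ_S(P)) ≥ log 10 − (8/10) log 8 = H_nats(1/10, 8/10, 1/10)`.
[folklore] -/
theorem cw8Entropy :
    ∀ m : ℕ, 1 ≤ m → ∀ P : Fin 3 × Fin 3 × Fin 3 → ℝ,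
      (∀ s, P s = ((if s = (1, 1, 0) then m * 5 else if s = (0, 1, 1) then m
          else if s = (1, 0, 1) then m * 3 else if s = (2, 0, 0) then m else 0 : ℕ) : ℝ) /
            (((10 * m : ℕ)) : ℝ)) →
      Real.log 10 - 8 / 10 * Real.log 8 ≤
        Real.log 2 * (min (shannonEntropy (marginalDist₁ P))
          (min (shannonEntropy (marginalDist₂ P)) (shannonEntropy (marginalDist₃ P))) -
          maxEntropyPenalty cwSupport₃ P) := by
  intro m hm P hP
  have hm0 : (m : ℝ) ≠ 0 := by exact_mod_cast (by omega : m ≠ 0)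
  -- the law as probabilities
  have hPp : ∀ s, P s = if s = (1, 1, 0) then 5 / 10 else if s = (0, 1, 1) then 1 / 10
      else if s = (1, 0, 1) then 3 / 10 else if s = (2, 0, 0) then 1 / 10 else 0 := by
    intro s
    rw [hP s]
    push_cast
    split_ifs <;> first | (field_simp; ring) | field_simp
  obtain ⟨hm₁, hm₂, hm₃⟩ := marginalDist_cert hPp
  have hpen : maxEntropyPenalty cwSupport₃ P ≤ 0 := maxEntropyPenalty_cert_nonpos hPp
  have hlog : 0 < Real.log 2 := Real.log_pos one_lt_two
  rw [hm₁, hm₂, hm₃, shannonEntropy_X, min_eq_left (le_min shannonEntropy_Y_ge shannonEntropy_Z_ge),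
    mul_sub, mul_div_cancel₀ _ hlog.ne']
  have h2 : Real.log 2 * maxEntropyPenalty cwSupport₃ P ≤ 0 :=
    mul_nonpos_of_nonneg_of_nonpos hlog.le hpen
  linarith

/-- Layers B1 + B2: the free diagonal of the joint type `(5m, m, 3m, m)` with the size bound in
closed form, `exp(N · (log 10 − (8/10) log 8)) ≤ |Δ| · (N+1)^63 · 192 · exp(4 √(log 6 + N log 27))`,
`N = 10 m`. [folklore] -/
theorem cw8Diagonal (m : ℕ) (hm : 1 ≤ m) :
    ∃ Δ : Finset ((Fin (10 * m) → Fin 3) × (Fin (10 * m) → Fin 3) × (Fin (10 * m) → Fin 3)),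
      (∀ δ ∈ Δ, ∀ ρ, labelSeq δ ρ ∈ cwSupport₃) ∧
      (∀ δ ∈ Δ, letterCount (labelSeq δ) (1, 1, 0) = m * 5 ∧ letterCount (labelSeq δ) (0, 1, 1) = m ∧
        letterCount (labelSeq δ) (1, 0, 1) = m * 3) ∧
      (∀ δ ∈ Δ, ∀ δ' ∈ Δ, ∀ δ'' ∈ Δ, (∀ ρ, (δ.1 ρ, δ'.2.1 ρ, δ''.2.2 ρ) ∈ cwSupport₃) →
        δ = δ' ∧ δ' = δ'') ∧
      Real.exp ((((10 * m : ℕ)) : ℝ) * (Real.log 10 - 8 / 10 * Real.log 8)) ≤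
        (Δ.card : ℝ) * ((((10 * m : ℕ)) : ℝ) + 1) ^ 63 * 192 *
          Real.exp (4 * Real.sqrt (Real.log 6 + (((10 * m : ℕ)) : ℝ) * Real.log 27)) := by
  set P : Fin 3 × Fin 3 × Fin 3 → ℝ := fun s =>
    ((if s = (1, 1, 0) then m * 5 else if s = (0, 1, 1) then m
        else if s = (1, 0, 1) then m * 3 else if s = (2, 0, 0) then m else 0 : ℕ) : ℝ) /
      (((10 * m : ℕ)) : ℝ) with hP
  have hPs : ∀ s, P s = ((if s = (1, 1, 0) then m * 5 else if s = (0, 1, 1) then m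
      else if s = (1, 0, 1) then m * 3 else if s = (2, 0, 0) then m else 0 : ℕ) : ℝ) /
      (((10 * m : ℕ)) : ℝ) := fun s => rfl
  obtain ⟨Δ, hS, hcnt, hfree, hsize⟩ := cw8DiagonalRaw m hm P hPs
  have hent := cw8Entropy m hm P hPs
  refine ⟨Δ, hS, hcnt, hfree, le_trans ?_ hsize⟩
  set X : ℝ := min (shannonEntropy (marginalDist₁ P))
      (min (shannonEntropy (marginalDist₂ P)) (shannonEntropy (marginalDist₃ P))) -
      maxEntropyPenalty cwSupport₃ P with hX
  have hN0 : (0 : ℝ) ≤ (((10 * m : ℕ)) : ℝ) := Nat.cast_nonneg _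
  rw [Real.rpow_def_of_pos two_pos, Real.exp_le_exp]
  calc (((10 * m : ℕ)) : ℝ) * (Real.log 10 - 8 / 10 * Real.log 8)
      ≤ (((10 * m : ℕ)) : ℝ) * (Real.log 2 * X) := mul_le_mul_of_nonneg_left hent hN0
    _ = Real.log 2 * ((((10 * m : ℕ)) : ℝ) * X) := by ring

end Summit.MatrixMultiplication.MatrixMultiplication.Theorems.SaturationLadderGradeOneThirdCert

end
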